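import Mathlib
import Literature.NumberTheory.LFunctions.Zhang2022.Section5Lemma54SizeTwo
import HarnessLib

/-!
# Zhang (2022), §5, Lemma 5.4 (ii) at the manuscript's parameter values: the `𝓛`-bookkeeping
# (`𝓛₂ = 𝓛⁴⁰⁰`, `𝓛₁ = 𝓛⁴⁰⁵`, `t₀ = 𝓛⁵¹⁹`, `α = π𝓛⁻⁹`), kernel-checked

Topic `Literature/NumberTheory/LFunctions/Zhang2022` (Landau–Siegel audit tree; verdict-neutral).
Y. Zhang, *Discrete mean estimates and the Landau–Siegel zero*, arXiv:2211.02515v1 (2022)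
[Zhang2022LandauSiegel] — **an unrefereed manuscript under adjudication** (D-0069 width campaign;
DAG node `Z22:Lem5.4` + `Z22:Lem5.4.pf`, PDF pp. 28–29, tex L1546–L1559; DISCHARGE.tsv row D07):

> **Lemma 5.4.** … (ii). If `|s − 1| < 10α`, then `δ(s) = 1 + O(α log 𝓛)`.
> *Proof.* (ii). Assume `|s − 1| < 10α`. By Lemma 5.3, on the right side of (5.14), the integral
> on the part `|x − t₀| ≥ 𝓛₁` contributes `O(ε)`. For `|x − t₀| < 𝓛₁` we have
> `x^{s−1} = 1 + O(α log 𝓛)`. Since `∫₀^∞ ω(1/2+2πix) dx = 1 + O(ε)`, (ii) follows.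

This file substitutes the manuscript's parameter values (as powers of a real `L = 𝓛 ≥ 4`) into
the free-parameter kernel theorems of the tree — the structure
`Lemma53.norm_delta514_sub_one_le_explicit` (`Section5Lemma54PartTwo`) and the far-part sizes of
`Section5Lemma54SizeTwo` — and does the bookkeeping:

* `Lemma53.near_coeff_le`, `tail_coeff_le`, `far_le` — the far part
  `∫_{(0,∞)∖(t₀−𝓛₁,t₀+𝓛₁)} ‖Δ‖x^{σ−1} ≤ (12·41! + 1344 + 5 + 18·10!)·𝓛⁻¹⁵` for `1/2 ≤ σ ≤ 3/2`
  (cut-off `X₀ = 𝓛⁵³⁰`, contour `U = π𝓛⁻²⁷⁰`, `ρ = √2·π𝓛⁻²⁷⁰`, `m = 3`, `N = 10`): the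
  manuscript's "contributes `O(ε)`" as an explicit power saving;
* `Lemma53.window_coeff_le`, `window_log_le`, `window_sΛ_le`, `window_contour` — the window
  `W = (t₀ − 𝓛₁, t₀ + 𝓛₁)`: `M_W ≤ 17592𝓛⁻¹⁵`, `|log x| ≤ Λ = log 2 + 519 log 𝓛` on `W`,
  `|s−1|Λ ≤ 1`, contour `U = π𝓛⁻³⁹⁵`, `ρ = √2·π𝓛⁻³⁹⁵`, `e^{−(π𝓛₁/𝓛₂)²} ≤ 𝓛⁻¹⁰`;
* `Lemma53.norm_delta514_sub_one_le_param` — **Lemma 5.4 (ii) with its size**: for `𝓛 ≥ 4` and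
  `|s − 1| < 10α`, `‖δ(s) − 1‖ ≤ C·α·log 𝓛` with an absolute (astronomically generous) `C`; the
  main term `2|s−1|Λ(M_W+1) ≤ 20800·α log 𝓛` is the manuscript's `O(α log 𝓛)`.

The skeleton node itself (`Skeleton.lemma54_holds`) is assembled in `Section5Lemma54Discharge`.
What is NOT asserted: anything about Theorems 1–2 of the source or about Landau–Siegel zeros;
nothing here bears on the cell's verdict on (8.24). A proof file: no new definitions, no new facts.

## References

* Y. Zhang, arXiv:2211.02515v1 (2022), §5 Lemma 5.3 (5.8)–(5.9), Lemma 5.4 (ii) and its proof;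
  §2 (2.1), (2.6), (2.8), (2.15). [cite: Zhang2022LandauSiegel, §5 Lemma 5.4 (ii)]
-/

noncomputable section

open Complex Real Set MeasureTheory Filter

namespace Literature.NumberTheory.LFunctions.Zhang2022

namespace Lemma53

open SmoothWeight

/-! ## Elementary facts about `𝓛 ≥ 4` -/

/-- `e^{−y} ≤ n!/yⁿ` for `y > 0`. [folklore] -/
private theorem exp_neg_le_factorial_div_pow' {y : ℝ} (hy : 0 < y) (n : ℕ) :
    Real.exp (-y) ≤ (n.factorial : ℝ) / y ^ n := by
  have h := Real.pow_div_factorial_le_exp y hy.le n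
  have hfac : (0 : ℝ) < n.factorial := by exact_mod_cast Nat.factorial_pos n
  rw [div_le_iff₀ hfac] at h
  have hyn : 0 < y ^ n := pow_pos hy n
  rw [Real.exp_neg, inv_le_iff_one_le_mul₀ (Real.exp_pos y), div_mul_eq_mul_div,
    one_le_div hyn]
  linarith

/-- `e^{−L^a} ≤ n!/L^{an}` for `L > 0`. [folklore] -/
private theorem exp_neg_pow_le {L : ℝ} (hL : 0 < L) (a n : ℕ) :
    Real.exp (-L ^ a) ≤ (n.factorial : ℝ) / L ^ (a * n) := by
  have h := exp_neg_le_factorial_div_pow' (pow_pos hL a) n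
  rwa [← pow_mul] at h

/-- `e^{−c·L^a} ≤ n!/L^{an}` for `L > 0` and `c ≥ 1`. [folklore] -/
private theorem exp_neg_mul_pow_le {L c : ℝ} (hL : 0 < L) (hc : 1 ≤ c) (a n : ℕ) :
    Real.exp (-(c * L ^ a)) ≤ (n.factorial : ℝ) / L ^ (a * n) := by
  refine le_trans (Real.exp_le_exp.mpr ?_) (exp_neg_pow_le hL a n)
  have : 0 ≤ L ^ a := pow_nonneg hL.le a
  nlinarith

/-- `π ≤ 4`, `√π ≤ 2`, `√(2π) ≤ 3`, `√2·π ≤ 8`, `e ≤ 3`, `1 ≤ π²/2`, `log 2 ≤ 1`. [folklore] -/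
private theorem numeric_consts :
    π ≤ 4 ∧ Real.sqrt π ≤ 2 ∧ Real.sqrt (2 * π) ≤ 3 ∧ Real.sqrt 2 * π ≤ 8 ∧ Real.exp 1 ≤ 3 ∧
      1 ≤ π ^ 2 / 2 ∧ Real.log 2 ≤ 1 := by
  have hpi4 : π ≤ 4 := Real.pi_le_four
  have hpi3 : 3 < π := Real.pi_gt_three
  refine ⟨hpi4, ?_, ?_, ?_, ?_, ?_, ?_⟩
  · calc Real.sqrt π ≤ Real.sqrt (2 ^ 2) := Real.sqrt_le_sqrt (by linarith)
      _ = 2 := Real.sqrt_sq (by norm_num)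
  · calc Real.sqrt (2 * π) ≤ Real.sqrt (3 ^ 2) := Real.sqrt_le_sqrt (by linarith)
      _ = 3 := Real.sqrt_sq (by norm_num)
  · have : Real.sqrt 2 ≤ 2 := by
      calc Real.sqrt 2 ≤ Real.sqrt (2 ^ 2) := Real.sqrt_le_sqrt (by norm_num)
        _ = 2 := Real.sqrt_sq (by norm_num)
    nlinarith [Real.sqrt_nonneg 2]
  · have := Real.exp_one_lt_d9; linarith
  · nlinarith
  · have := Real.log_two_lt_d9; linarith

/-! ## Part (ii) under the manuscript's parameters: the far part -/

/-- The near part's coefficient: with `𝓛₂ = 𝓛⁴⁰⁰`, `𝓛₁ = 𝓛⁴⁰⁵`, `U = π𝓛⁻²⁷⁰`, the off-window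
bound `B` of `Lemma53.norm_Delta510_le_off_window` satisfies `B·(2𝓛⁷⁹⁵) ≤ (12·41! + 1344)𝓛⁻¹⁵`
for `𝓛 ≥ 4` (`e^{−π²𝓛¹⁰} ≤ 41!𝓛⁻⁴¹⁰`, `e^{−π²𝓛²⁶⁰/2}, e^{−π²𝓛²⁶⁰} ≤ 4!𝓛⁻¹⁰⁴⁰`).
[cite: Zhang2022LandauSiegel, §5 Lemma 5.4 (ii) (proof)] -/
theorem near_coeff_le {L : ℝ} (hL : 4 ≤ L) :
    (3 * (Real.sqrt π / L ^ 400 * Real.exp (-(π * L ^ 405 / L ^ 400) ^ 2))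
        + (1 + Real.exp (1 / (8 * (L ^ 400) ^ 2))) * (Real.sqrt (2 * π) / L ^ 400)
            * Real.exp (-((L ^ 400) ^ 2 * (π / L ^ 270) ^ 2 / 2))
        + 4 * (π / L ^ 270) * Real.exp (-((L ^ 400) ^ 2 * (π / L ^ 270) ^ 2)))
      * (2 * L ^ 795)
      ≤ (12 * (Nat.factorial 41 : ℝ) + 1344) / L ^ 15 := by
  obtain ⟨hpi4, hsqpi, hsq2pi, _, he3, hpi22, _⟩ := numeric_consts
  have hL1 : 1 ≤ L := by linarith
  have hL0 : 0 < L := by linarith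
  have hpow : ∀ a b : ℕ, a ≤ b → L ^ a ≤ L ^ b := fun a b h => pow_le_pow_right₀ hL1 h
  have hpi1 : 1 ≤ π ^ 2 := by nlinarith [Real.pi_gt_three]
  -- the three exponentials
  have e1 : (π * L ^ 405 / L ^ 400) ^ 2 = π ^ 2 * L ^ 10 := by
    field_simp
  have e2 : (L ^ 400) ^ 2 * (π / L ^ 270) ^ 2 / 2 = π ^ 2 / 2 * L ^ 260 := by
    field_simp
  have e3 : (L ^ 400) ^ 2 * (π / L ^ 270) ^ 2 = π ^ 2 * L ^ 260 := by
    field_simp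
  have hx1 : Real.exp (-(π * L ^ 405 / L ^ 400) ^ 2) ≤ (Nat.factorial 41 : ℝ) / L ^ 410 := by
    rw [e1]; exact (exp_neg_mul_pow_le hL0 hpi1 10 41).trans (by norm_num)
  have hx2 : Real.exp (-((L ^ 400) ^ 2 * (π / L ^ 270) ^ 2 / 2)) ≤ (Nat.factorial 4 : ℝ) / L ^ 1040 := by
    rw [e2]; exact (exp_neg_mul_pow_le hL0 hpi22 260 4).trans (by norm_num)
  have hx3 : Real.exp (-((L ^ 400) ^ 2 * (π / L ^ 270) ^ 2)) ≤ (Nat.factorial 4 : ℝ) / L ^ 1040 := by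
    rw [e3]; exact (exp_neg_mul_pow_le hL0 hpi1 260 4).trans (by norm_num)
  have h4fac : (Nat.factorial 4 : ℝ) = 24 := by norm_num
  rw [h4fac] at hx2 hx3
  -- the prefactors
  have hA : Real.sqrt π / L ^ 400 ≤ 2 / L ^ 400 := by gcongr
  have hexp8 : Real.exp (1 / (8 * (L ^ 400) ^ 2)) ≤ 3 := by
    refine le_trans (Real.exp_le_exp.mpr ?_) he3
    rw [div_le_one (by positivity)]; nlinarith [one_le_pow₀ (n := 400) hL1]
  have hB : (1 + Real.exp (1 / (8 * (L ^ 400) ^ 2))) * (Real.sqrt (2 * π) / L ^ 400)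
      ≤ 4 * (3 / L ^ 400) := by gcongr; linarith
  have hC : 4 * (π / L ^ 270) ≤ 16 / L ^ 270 := by
    rw [show (16 : ℝ) / L ^ 270 = 4 * (4 / L ^ 270) by ring]; gcongr
  -- termwise
  have hf0 : (0 : ℝ) ≤ Nat.factorial 41 := Nat.cast_nonneg _
  have hT1 : 3 * (Real.sqrt π / L ^ 400 * Real.exp (-(π * L ^ 405 / L ^ 400) ^ 2)) * (2 * L ^ 795)
      ≤ 12 * (Nat.factorial 41 : ℝ) / L ^ 15 := by
    calc 3 * (Real.sqrt π / L ^ 400 * Real.exp (-(π * L ^ 405 / L ^ 400) ^ 2)) * (2 * L ^ 795)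
        ≤ 3 * (2 / L ^ 400 * ((Nat.factorial 41 : ℝ) / L ^ 410)) * (2 * L ^ 795) := by
          gcongr
      _ = 12 * (Nat.factorial 41 : ℝ) / L ^ 15 := by field_simp; ring
  have hT2 : (1 + Real.exp (1 / (8 * (L ^ 400) ^ 2))) * (Real.sqrt (2 * π) / L ^ 400)
          * Real.exp (-((L ^ 400) ^ 2 * (π / L ^ 270) ^ 2 / 2)) * (2 * L ^ 795)
      ≤ 576 / L ^ 645 := by
    calc (1 + Real.exp (1 / (8 * (L ^ 400) ^ 2))) * (Real.sqrt (2 * π) / L ^ 400)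
          * Real.exp (-((L ^ 400) ^ 2 * (π / L ^ 270) ^ 2 / 2)) * (2 * L ^ 795)
        ≤ 4 * (3 / L ^ 400) * (24 / L ^ 1040) * (2 * L ^ 795) := by gcongr
      _ = 576 / L ^ 645 := by field_simp; ring
  have hT3 : 4 * (π / L ^ 270) * Real.exp (-((L ^ 400) ^ 2 * (π / L ^ 270) ^ 2)) * (2 * L ^ 795)
      ≤ 768 / L ^ 515 := by
    calc 4 * (π / L ^ 270) * Real.exp (-((L ^ 400) ^ 2 * (π / L ^ 270) ^ 2)) * (2 * L ^ 795)
        ≤ 16 / L ^ 270 * (24 / L ^ 1040) * (2 * L ^ 795) := by gcongr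
      _ = 768 / L ^ 515 := by field_simp; ring
  have h645 : (576 : ℝ) / L ^ 645 ≤ 576 / L ^ 15 :=
    div_le_div_of_nonneg_left (by norm_num) (by positivity) (hpow 15 645 (by norm_num))
  have h515 : (768 : ℝ) / L ^ 515 ≤ 768 / L ^ 15 :=
    div_le_div_of_nonneg_left (by norm_num) (by positivity) (hpow 15 515 (by norm_num))
  have hsum := add_le_add (add_le_add hT1 hT2) hT3
  calc _ = 3 * (Real.sqrt π / L ^ 400 * Real.exp (-(π * L ^ 405 / L ^ 400) ^ 2)) * (2 * L ^ 795)
        + (1 + Real.exp (1 / (8 * (L ^ 400) ^ 2))) * (Real.sqrt (2 * π) / L ^ 400)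
            * Real.exp (-((L ^ 400) ^ 2 * (π / L ^ 270) ^ 2 / 2)) * (2 * L ^ 795)
        + 4 * (π / L ^ 270) * Real.exp (-((L ^ 400) ^ 2 * (π / L ^ 270) ^ 2)) * (2 * L ^ 795) := by
        ring
    _ ≤ 12 * (Nat.factorial 41 : ℝ) / L ^ 15 + 576 / L ^ 645 + 768 / L ^ 515 := hsum
    _ ≤ 12 * (Nat.factorial 41 : ℝ) / L ^ 15 + 576 / L ^ 15 + 768 / L ^ 15 := by linarith
    _ = (12 * (Nat.factorial 41 : ℝ) + 1344) / L ^ 15 := by ring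

/-- The tail's coefficient: with `𝓛₂ = 𝓛⁴⁰⁰`, `X₀ = 𝓛⁵³⁰`, `m = 3`, `N = 10`, the tail bound `T` of
`Lemma53.integral_Ioi_norm_Delta510_mul_rpow_le` satisfies `T ≤ (5 + 18·10!)𝓛⁻¹⁵` for `𝓛 ≥ 4` and
`σ ≤ 3/2` (`X₀^{σ−3} ≤ X₀⁻¹ = 𝓛⁻⁵³⁰`, `𝓛₂¹⁰X₀^{σ−9.9} ≤ 𝓛⁴⁰⁰⁰X₀⁻⁸ = 𝓛⁻²⁴⁰`).
[cite: Zhang2022LandauSiegel, §5 Lemma 5.4 (ii) (proof)] -/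
theorem tail_coeff_le {L σ : ℝ} (hL : 4 ≤ L) (hσ2 : σ ≤ 3 / 2) :
    (2 + Real.exp 1 / L ^ 400) * ((L ^ 530) ^ (σ - ((3 : ℕ) : ℝ)) / (((3 : ℕ) : ℝ) - σ))
        + Real.exp (1 + 1 / (16 * (L ^ 400) ^ 2)) * (Real.sqrt π / L ^ 400)
            * ((Nat.factorial 10 : ℝ) * (L ^ 400) ^ 10)
            * ((L ^ 530) ^ (σ - 99 / 100 * ((10 : ℕ) : ℝ)) / (99 / 100 * ((10 : ℕ) : ℝ) - σ))
      ≤ (5 + 18 * (Nat.factorial 10 : ℝ)) / L ^ 15 := by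
  obtain ⟨hpi4, hsqpi, _, _, he3, _, _⟩ := numeric_consts
  have hL1 : 1 ≤ L := by linarith
  have hL0 : 0 < L := by linarith
  have hpow : ∀ a b : ℕ, a ≤ b → L ^ a ≤ L ^ b := fun a b h => pow_le_pow_right₀ hL1 h
  have hX1 : (1 : ℝ) ≤ L ^ 530 := one_le_pow₀ hL1
  have hX0 : (0 : ℝ) < L ^ 530 := by positivity
  have hf0 : (0 : ℝ) ≤ Nat.factorial 10 := Nat.cast_nonneg _
  push_cast
  -- first term
  have hA : 2 + Real.exp 1 / L ^ 400 ≤ 5 := by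
    have : Real.exp 1 / L ^ 400 ≤ Real.exp 1 := div_le_self (Real.exp_pos 1).le (one_le_pow₀ hL1)
    linarith
  have h1 : (L ^ 530) ^ (σ - 3) / (3 - σ) ≤ 1 / L ^ 530 := by
    have ha : (L ^ 530) ^ (σ - 3) ≤ (L ^ 530) ^ (-(1 : ℝ)) :=
      Real.rpow_le_rpow_of_exponent_le hX1 (by linarith)
    rw [Real.rpow_neg_one, ← one_div] at ha
    have h0 : 0 ≤ (L ^ 530) ^ (σ - 3) := Real.rpow_nonneg hX0.le _
    exact (div_le_self h0 (by linarith)).trans ha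
  have hT1 : (2 + Real.exp 1 / L ^ 400) * ((L ^ 530) ^ (σ - 3) / (3 - σ)) ≤ 5 / L ^ 530 := by
    have h0 : 0 ≤ (L ^ 530) ^ (σ - 3) / (3 - σ) := div_nonneg (Real.rpow_nonneg hX0.le _) (by linarith)
    calc (2 + Real.exp 1 / L ^ 400) * ((L ^ 530) ^ (σ - 3) / (3 - σ)) ≤ 5 * (1 / L ^ 530) :=
          mul_le_mul hA h1 h0 (by norm_num)
      _ = 5 / L ^ 530 := by ring
  -- second term
  have hE : Real.exp (1 + 1 / (16 * (L ^ 400) ^ 2)) ≤ 9 := by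
    have h16 : 1 / (16 * (L ^ 400) ^ 2) ≤ 1 := by
      rw [div_le_one (by positivity)]; nlinarith [one_le_pow₀ (n := 400) hL1]
    calc Real.exp (1 + 1 / (16 * (L ^ 400) ^ 2)) ≤ Real.exp (1 + 1) := Real.exp_le_exp.mpr (by linarith)
      _ = Real.exp 1 * Real.exp 1 := by rw [Real.exp_add]
      _ ≤ 3 * 3 := mul_le_mul he3 he3 (Real.exp_pos 1).le (by norm_num)
      _ = 9 := by norm_num
  have hS : Real.sqrt π / L ^ 400 ≤ 2 := (div_le_self (Real.sqrt_nonneg π) (one_le_pow₀ hL1)).trans hsqpi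
  have hP : (Nat.factorial 10 : ℝ) * (L ^ 400) ^ 10 = (Nat.factorial 10 : ℝ) * L ^ 4000 := by
    rw [← pow_mul]
  have h2 : (L ^ 530) ^ (σ - 99 / 100 * 10) / (99 / 100 * 10 - σ) ≤ 1 / L ^ 4240 := by
    have ha : (L ^ 530) ^ (σ - 99 / 100 * 10) ≤ (L ^ 530) ^ (-((8 : ℕ) : ℝ)) :=
      Real.rpow_le_rpow_of_exponent_le hX1 (by norm_num; linarith)
    rw [Real.rpow_neg hX0.le, Real.rpow_natCast, ← pow_mul, ← one_div] at ha
    have h0 : 0 ≤ (L ^ 530) ^ (σ - 99 / 100 * 10) := Real.rpow_nonneg hX0.le _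
    exact (div_le_self h0 (by linarith)).trans (ha.trans (by norm_num))
  have hT2 : Real.exp (1 + 1 / (16 * (L ^ 400) ^ 2)) * (Real.sqrt π / L ^ 400)
          * ((Nat.factorial 10 : ℝ) * (L ^ 400) ^ 10)
          * ((L ^ 530) ^ (σ - 99 / 100 * 10) / (99 / 100 * 10 - σ))
      ≤ 18 * (Nat.factorial 10 : ℝ) / L ^ 240 := by
    have h0 : 0 ≤ (L ^ 530) ^ (σ - 99 / 100 * 10) / (99 / 100 * 10 - σ) :=
      div_nonneg (Real.rpow_nonneg hX0.le _) (by linarith)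
    rw [hP]
    calc Real.exp (1 + 1 / (16 * (L ^ 400) ^ 2)) * (Real.sqrt π / L ^ 400)
          * ((Nat.factorial 10 : ℝ) * L ^ 4000)
          * ((L ^ 530) ^ (σ - 99 / 100 * 10) / (99 / 100 * 10 - σ))
        ≤ 9 * 2 * ((Nat.factorial 10 : ℝ) * L ^ 4000) * (1 / L ^ 4240) := by
          gcongr
      _ = 18 * (Nat.factorial 10 : ℝ) / L ^ 240 := by field_simp; ring
  have h530 : (5 : ℝ) / L ^ 530 ≤ 5 / L ^ 15 :=
    div_le_div_of_nonneg_left (by norm_num) (by positivity) (hpow 15 530 (by norm_num))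
  have h240 : 18 * (Nat.factorial 10 : ℝ) / L ^ 240 ≤ 18 * (Nat.factorial 10 : ℝ) / L ^ 15 :=
    div_le_div_of_nonneg_left (by positivity) (by positivity) (hpow 15 240 (by norm_num))
  calc _ ≤ 5 / L ^ 530 + 18 * (Nat.factorial 10 : ℝ) / L ^ 240 := add_le_add hT1 hT2
    _ ≤ 5 / L ^ 15 + 18 * (Nat.factorial 10 : ℝ) / L ^ 15 := add_le_add h530 h240
    _ = (5 + 18 * (Nat.factorial 10 : ℝ)) / L ^ 15 := by ring

/-- **The far part under the manuscript's parameters**: for `𝓛 ≥ 4` and `1/2 ≤ σ ≤ 3/2`,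
`∫_{(0,∞)∖(t₀−𝓛₁,t₀+𝓛₁)} ‖Δ(x)‖x^{σ−1} dx ≤ (12·41! + 1344 + 5 + 18·10!)·𝓛⁻¹⁵` — the
manuscript's "contributes `O(ε)`", here as an explicit (astronomically generous) power saving.
[cite: Zhang2022LandauSiegel, §5 Lemma 5.4 (ii) (proof)] -/
theorem far_le {L σ : ℝ} (hL : 4 ≤ L) (hσ1 : 1 / 2 ≤ σ) (hσ2 : σ ≤ 3 / 2) :
    ∫ x in Ioi 0 \ Ioo (L ^ 519 - L ^ 405) (L ^ 519 + L ^ 405),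
        ‖Delta510 (L ^ 400) (L ^ 519) x‖ * x ^ (σ - 1)
      ≤ (12 * (Nat.factorial 41 : ℝ) + 1344 + (5 + 18 * (Nat.factorial 10 : ℝ))) / L ^ 15 := by
  obtain ⟨hpi4, _, _, hsq2pi, he3, _, _⟩ := numeric_consts
  have hL1 : 1 ≤ L := by linarith
  have hL0 : 0 < L := by linarith
  have hpow : ∀ a b : ℕ, a ≤ b → L ^ a ≤ L ^ b := fun a b h => pow_le_pow_right₀ hL1 h
  have h4pow : ∀ n : ℕ, (4 : ℝ) ^ n ≤ L ^ n := fun n => pow_le_pow_left₀ (by norm_num) hL n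
  have hL₂1 : (1 : ℝ) ≤ L ^ 400 := one_le_pow₀ hL1
  have hL₂0 : (0 : ℝ) < L ^ 400 := by positivity
  have ht₀0 : (0 : ℝ) < L ^ 519 := by positivity
  have hX₀1 : (1 : ℝ) ≤ L ^ 530 := one_le_pow₀ hL1
  have hX₀0 : (0 : ℝ) < L ^ 530 := by positivity
  have hσ0 : 0 < σ := by linarith
  -- contour parameters for the near part: `U = π𝓛⁻²⁷⁰`, `ρ = √2·π𝓛⁻²⁷⁰`
  have hU : π * L ^ 530 / (L ^ 400) ^ 2 ≤ π / L ^ 270 := le_of_eq (by field_simp)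
  have hρ : Real.sqrt 2 * (π / L ^ 270) ≤ Real.sqrt 2 * π / L ^ 270 := le_of_eq (by ring)
  have hρ1 : Real.sqrt 2 * π / L ^ 270 ≤ 1 := by
    rw [div_le_one (by positivity)]
    calc Real.sqrt 2 * π ≤ 8 := hsq2pi
      _ ≤ 4 ^ 2 := by norm_num
      _ ≤ L ^ 2 := h4pow 2
      _ ≤ L ^ 270 := hpow 2 270 (by norm_num)
  have hxρ : 4 * π * L ^ 530 * (Real.sqrt 2 * π / L ^ 270) ^ 2 ≤ 1 := by
    have e : 4 * π * L ^ 530 * (Real.sqrt 2 * π / L ^ 270) ^ 2 = 8 * π ^ 3 / L ^ 10 := by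
      rw [div_pow, mul_pow, Real.sq_sqrt (by norm_num : (0 : ℝ) ≤ 2)]
      field_simp
      ring
    rw [e, div_le_one (by positivity)]
    calc 8 * π ^ 3 ≤ 8 * 4 ^ 3 := by gcongr
      _ ≤ 4 ^ 5 := by norm_num
      _ ≤ L ^ 5 := h4pow 5
      _ ≤ L ^ 10 := hpow 5 10 (by norm_num)
  have hnear : ∀ x : ℝ, 0 < x → x ≤ L ^ 530 → L ^ 405 ≤ |x - L ^ 519| →
      ‖Delta510 (L ^ 400) (L ^ 519) x‖
        ≤ 3 * (Real.sqrt π / L ^ 400 * Real.exp (-(π * L ^ 405 / L ^ 400) ^ 2))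
          + (1 + Real.exp (1 / (8 * (L ^ 400) ^ 2))) * (Real.sqrt (2 * π) / L ^ 400)
              * Real.exp (-((L ^ 400) ^ 2 * (π / L ^ 270) ^ 2 / 2))
          + 4 * (π / L ^ 270) * Real.exp (-((L ^ 400) ^ 2 * (π / L ^ 270) ^ 2)) :=
    fun x hx0 hxX hxt => norm_Delta510_le_off_window hL₂0 ht₀0 (hpow 519 530 (by norm_num))
      (by positivity) hx0 hxX hxt hU hρ hρ1 hxρ
  have hB0 : 0 ≤ 3 * (Real.sqrt π / L ^ 400 * Real.exp (-(π * L ^ 405 / L ^ 400) ^ 2))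
      + (1 + Real.exp (1 / (8 * (L ^ 400) ^ 2))) * (Real.sqrt (2 * π) / L ^ 400)
          * Real.exp (-((L ^ 400) ^ 2 * (π / L ^ 270) ^ 2 / 2))
      + 4 * (π / L ^ 270) * Real.exp (-((L ^ 400) ^ 2 * (π / L ^ 270) ^ 2)) := by positivity
  -- the tail beyond `X₀ = 𝓛⁵³⁰`
  have hX₀e : Real.exp 1 ≤ L ^ 530 := by
    calc Real.exp 1 ≤ 3 := he3
      _ ≤ L := by linarith
      _ ≤ L ^ 530 := le_self_pow₀ hL1 (by norm_num)
  have ht : 2 * L ^ 519 < (L ^ 530) ^ (99 / 100 : ℝ) := by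
    have e : (L ^ 530 : ℝ) ^ (99 / 100 : ℝ) = L ^ (((530 : ℕ) : ℝ) * (99 / 100)) := by
      rw [← Real.rpow_natCast L 530, ← Real.rpow_mul hL0.le]
    have h520 : L ^ 520 ≤ (L ^ 530 : ℝ) ^ (99 / 100 : ℝ) := by
      rw [e, ← Real.rpow_natCast L 520]
      exact Real.rpow_le_rpow_of_exponent_le hL1 (by norm_num)
    have h2 : 2 * L ^ 519 < L ^ 520 := by
      rw [show L ^ 520 = L * L ^ 519 by ring]
      exact mul_lt_mul_of_pos_right (by linarith) ht₀0
    exact lt_of_lt_of_le h2 h520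
  have hm : (10 : ℝ) ^ 4 * ((3 : ℕ) : ℝ) ≤ (L ^ 400) ^ 2 := by
    calc (10 : ℝ) ^ 4 * ((3 : ℕ) : ℝ) ≤ 4 ^ 8 := by norm_num
      _ ≤ L ^ 8 := h4pow 8
      _ ≤ L ^ 800 := hpow 8 800 (by norm_num)
      _ = (L ^ 400) ^ 2 := by rw [← pow_mul]
  have htail := integral_Ioi_norm_Delta510_mul_rpow_le (t₀ := L ^ 519) hL₂1 hX₀e ht hσ0 hσ2
    (m := 3) (by norm_num) hm (N := 10) (by norm_num)
  have hfar := integral_far_le (t₀ := L ^ 519) (ℓ := L ^ 405) hL₂1 hσ0 hX₀0 hB0 hnear htail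
  refine hfar.trans ?_
  -- `X₀^σ/σ ≤ 2𝓛⁷⁹⁵`
  have hXσ : (L ^ 530 : ℝ) ^ σ / σ ≤ 2 * L ^ 795 := by
    have e : (L ^ 530 : ℝ) ^ ((3 : ℝ) / 2) = L ^ 795 := by
      rw [← Real.rpow_natCast L 530, ← Real.rpow_mul hL0.le, ← Real.rpow_natCast L 795]
      norm_num
    have h1 : (L ^ 530 : ℝ) ^ σ ≤ L ^ 795 := by
      rw [← e]; exact Real.rpow_le_rpow_of_exponent_le hX₀1 hσ2
    have h0 : (0 : ℝ) ≤ L ^ 795 := by positivity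
    calc (L ^ 530 : ℝ) ^ σ / σ ≤ L ^ 795 / (1 / 2) :=
          div_le_div₀ h0 h1 (by norm_num) hσ1
      _ = 2 * L ^ 795 := by ring
  have hnearC := near_coeff_le hL
  have htailC := tail_coeff_le hL hσ2
  rw [add_div]
  refine add_le_add (le_trans ?_ hnearC) htailC
  exact mul_le_mul_of_nonneg_left hXσ hB0

/-! ## Part (ii): the window terms and the assembly -/

/-- The window constant `M_W` of `Lemma53.norm_delta514_sub_one_le_explicit` at `𝓛₂ = 𝓛⁴⁰⁰`,
`𝓛₁ = 𝓛⁴⁰⁵`, `t₀ = 𝓛⁵¹⁹`, `U = π𝓛⁻³⁹⁵`, `ρ = √2·π𝓛⁻³⁹⁵` satisfies `M_W ≤ 17592·𝓛⁻¹⁵` for `𝓛 ≥ 4`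
(`𝓛₂²U² = π²𝓛¹⁰`, `ρ + 4π(t₀+𝓛₁)ρ² ≤ 1032𝓛⁻²⁷¹`, `1 + 4π𝓛₁²/𝓛₂² ≤ 17𝓛¹⁰`).
[cite: Zhang2022LandauSiegel, §5 Lemma 5.4 (ii) (proof)] -/
theorem window_coeff_le {L : ℝ} (hL : 4 ≤ L) :
    2 * L ^ 405 * ((1 + Real.exp (1 / (8 * (L ^ 400) ^ 2))) * (Real.sqrt (2 * π) / L ^ 400)
          * Real.exp (-((L ^ 400) ^ 2 * (π / L ^ 395) ^ 2 / 2)))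
      + (Real.sqrt 2 * π / L ^ 395 + 4 * π * (L ^ 519 + L ^ 405) * (Real.sqrt 2 * π / L ^ 395) ^ 2)
          * (1 + 4 * π * (L ^ 405) ^ 2 / (L ^ 400) ^ 2
              * Real.exp (-((L ^ 400) ^ 2 * (π / L ^ 395) ^ 2)))
      ≤ 17592 / L ^ 15 := by
  obtain ⟨hpi4, _, hsq2pi3, hsq2pi, he3, hpi22, _⟩ := numeric_consts
  have hL1 : 1 ≤ L := by linarith
  have hL0 : 0 < L := by linarith
  have hpow : ∀ a b : ℕ, a ≤ b → L ^ a ≤ L ^ b := fun a b h => pow_le_pow_right₀ hL1 h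
  have h4pow : ∀ n : ℕ, (4 : ℝ) ^ n ≤ L ^ n := fun n => pow_le_pow_left₀ (by norm_num) hL n
  -- exponentials
  have e1 : (L ^ 400) ^ 2 * (π / L ^ 395) ^ 2 / 2 = π ^ 2 / 2 * L ^ 10 := by field_simp
  have hx1 : Real.exp (-((L ^ 400) ^ 2 * (π / L ^ 395) ^ 2 / 2)) ≤ 2 / L ^ 20 := by
    rw [e1]; exact (exp_neg_mul_pow_le hL0 hpi22 10 2).trans (by norm_num)
  have hx2 : Real.exp (-((L ^ 400) ^ 2 * (π / L ^ 395) ^ 2)) ≤ 1 :=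
    Real.exp_le_one_iff.mpr (by rw [neg_nonpos]; positivity)
  -- first term
  have hexp8 : Real.exp (1 / (8 * (L ^ 400) ^ 2)) ≤ 3 := by
    refine le_trans (Real.exp_le_exp.mpr ?_) he3
    rw [div_le_one (by positivity)]; nlinarith [one_le_pow₀ (n := 400) hL1]
  have hT1 : 2 * L ^ 405 * ((1 + Real.exp (1 / (8 * (L ^ 400) ^ 2))) * (Real.sqrt (2 * π) / L ^ 400)
          * Real.exp (-((L ^ 400) ^ 2 * (π / L ^ 395) ^ 2 / 2))) ≤ 48 / L ^ 15 := by
    calc 2 * L ^ 405 * ((1 + Real.exp (1 / (8 * (L ^ 400) ^ 2))) * (Real.sqrt (2 * π) / L ^ 400)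
          * Real.exp (-((L ^ 400) ^ 2 * (π / L ^ 395) ^ 2 / 2)))
        ≤ 2 * L ^ 405 * ((1 + 3) * (3 / L ^ 400) * (2 / L ^ 20)) := by gcongr
      _ = 48 / L ^ 15 := by field_simp; ring
  -- second term
  have hρ : Real.sqrt 2 * π / L ^ 395 ≤ 8 / L ^ 271 := by
    calc Real.sqrt 2 * π / L ^ 395 ≤ 8 / L ^ 395 := by gcongr
      _ ≤ 8 / L ^ 271 := div_le_div_of_nonneg_left (by norm_num) (by positivity) (hpow 271 395 (by norm_num))
  have hρ2 : 4 * π * (L ^ 519 + L ^ 405) * (Real.sqrt 2 * π / L ^ 395) ^ 2 ≤ 1024 / L ^ 271 := by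
    have e : 4 * π * (L ^ 519 + L ^ 405) * (Real.sqrt 2 * π / L ^ 395) ^ 2
        = 8 * π ^ 3 * (L ^ 519 + L ^ 405) / L ^ 790 := by
      rw [div_pow, mul_pow, Real.sq_sqrt (by norm_num : (0 : ℝ) ≤ 2)]
      field_simp
      ring
    rw [e]
    have h2 : L ^ 519 + L ^ 405 ≤ 2 * L ^ 519 := by linarith [hpow 405 519 (by norm_num)]
    calc 8 * π ^ 3 * (L ^ 519 + L ^ 405) / L ^ 790 ≤ 8 * 4 ^ 3 * (2 * L ^ 519) / L ^ 790 := by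
          gcongr
      _ = 1024 / L ^ 271 := by field_simp; ring
  have hthird : 1 + 4 * π * (L ^ 405) ^ 2 / (L ^ 400) ^ 2
        * Real.exp (-((L ^ 400) ^ 2 * (π / L ^ 395) ^ 2)) ≤ 17 * L ^ 10 := by
    have e : 4 * π * (L ^ 405) ^ 2 / (L ^ 400) ^ 2 = 4 * π * L ^ 10 := by field_simp
    rw [e]
    have h10 : (1 : ℝ) ≤ L ^ 10 := one_le_pow₀ hL1
    have hpos : 0 ≤ 4 * π * L ^ 10 := by positivity
    calc 1 + 4 * π * L ^ 10 * Real.exp (-((L ^ 400) ^ 2 * (π / L ^ 395) ^ 2))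
        ≤ 1 + 4 * π * L ^ 10 * 1 := by gcongr
      _ ≤ L ^ 10 + 4 * 4 * L ^ 10 := by nlinarith
      _ = 17 * L ^ 10 := by ring
  have hsecond0 : 0 ≤ Real.sqrt 2 * π / L ^ 395
      + 4 * π * (L ^ 519 + L ^ 405) * (Real.sqrt 2 * π / L ^ 395) ^ 2 := by positivity
  have hthird0 : 0 ≤ 1 + 4 * π * (L ^ 405) ^ 2 / (L ^ 400) ^ 2
      * Real.exp (-((L ^ 400) ^ 2 * (π / L ^ 395) ^ 2)) := by positivity
  have hT2 : (Real.sqrt 2 * π / L ^ 395 + 4 * π * (L ^ 519 + L ^ 405) * (Real.sqrt 2 * π / L ^ 395) ^ 2)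
          * (1 + 4 * π * (L ^ 405) ^ 2 / (L ^ 400) ^ 2
              * Real.exp (-((L ^ 400) ^ 2 * (π / L ^ 395) ^ 2)))
      ≤ 17544 / L ^ 261 := by
    calc (Real.sqrt 2 * π / L ^ 395 + 4 * π * (L ^ 519 + L ^ 405) * (Real.sqrt 2 * π / L ^ 395) ^ 2)
          * (1 + 4 * π * (L ^ 405) ^ 2 / (L ^ 400) ^ 2
              * Real.exp (-((L ^ 400) ^ 2 * (π / L ^ 395) ^ 2)))
        ≤ (8 / L ^ 271 + 1024 / L ^ 271) * (17 * L ^ 10) :=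
          mul_le_mul (add_le_add hρ hρ2) hthird hthird0 (by positivity)
      _ = 17544 / L ^ 261 := by field_simp; ring
  have h261 : (17544 : ℝ) / L ^ 261 ≤ 17544 / L ^ 15 :=
    div_le_div_of_nonneg_left (by norm_num) (by positivity) (hpow 15 261 (by norm_num))
  calc _ ≤ 48 / L ^ 15 + 17544 / L ^ 261 := add_le_add hT1 hT2
    _ ≤ 48 / L ^ 15 + 17544 / L ^ 15 := by linarith
    _ = 17592 / L ^ 15 := by ring

/-- Window bookkeeping for `𝓛 ≥ 4`: `t₀ − 𝓛₁ ≥ 1`, so `|log x| ≤ log 2 + 519 log 𝓛 =: Λ` on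
`W = (t₀ − 𝓛₁, t₀ + 𝓛₁)`. [cite: Zhang2022LandauSiegel, §5 Lemma 5.4 (ii) (proof)] -/
theorem window_log_le {L : ℝ} (hL : 4 ≤ L) :
    ∀ x ∈ Ioo (L ^ 519 - L ^ 405) (L ^ 519 + L ^ 405),
      |Real.log x| ≤ Real.log 2 + 519 * Real.log L := by
  have hL1 : 1 ≤ L := by linarith
  have hL0 : 0 < L := by linarith
  have hℓ : (0 : ℝ) < L ^ 405 := by positivity
  have hℓt : L ^ 405 ≤ L ^ 519 := pow_le_pow_right₀ hL1 (by norm_num)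
  have hwin1 : (1 : ℝ) ≤ L ^ 519 - L ^ 405 := by
    have h1 : (1 : ℝ) ≤ L ^ 405 := one_le_pow₀ hL1
    have h114 : (2 : ℝ) ≤ L ^ 114 := le_trans (by linarith) (le_self_pow₀ hL1 (by norm_num))
    have h2 : 2 * L ^ 405 ≤ L ^ 519 := by
      rw [show L ^ 519 = L ^ 114 * L ^ 405 by ring]
      exact mul_le_mul_of_nonneg_right h114 hℓ.le
    linarith
  intro x hx
  have hx1 : 1 ≤ x := hwin1.trans hx.1.le
  have hx0 : 0 < x := by linarith
  rw [abs_of_nonneg (Real.log_nonneg hx1)]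
  have hx2 : x ≤ 2 * L ^ 519 := by linarith [hx.2]
  calc Real.log x ≤ Real.log (2 * L ^ 519) := Real.log_le_log hx0 hx2
    _ = Real.log 2 + 519 * Real.log L := by
        rw [Real.log_mul (by norm_num) (by positivity), Real.log_pow]; push_cast; ring

/-- Window bookkeeping for `𝓛 ≥ 4`: `|s − 1| < 10α` gives `|s − 1|·Λ ≤ 5200π𝓛⁻⁸ ≤ 1`.
[cite: Zhang2022LandauSiegel, §5 Lemma 5.4 (ii) (proof)] -/
theorem window_sΛ_le {L : ℝ} (hL : 4 ≤ L) {s : ℂ} (hs : ‖s - 1‖ < 10 * (π / L ^ 9)) :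
    ‖s - 1‖ * (Real.log 2 + 519 * Real.log L) ≤ 1 := by
  obtain ⟨hpi4, _, _, _, _, _, hlog2⟩ := numeric_consts
  have hL1 : 1 ≤ L := by linarith
  have hL0 : 0 < L := by linarith
  have h4pow : ∀ n : ℕ, (4 : ℝ) ^ n ≤ L ^ n := fun n => pow_le_pow_left₀ (by norm_num) hL n
  have hlogL : Real.log L ≤ L := (Real.log_le_sub_one_of_pos hL0).trans (by linarith)
  have hΛ0 : 0 ≤ Real.log 2 + 519 * Real.log L := by
    have := Real.log_nonneg (by norm_num : (1 : ℝ) ≤ 2)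
    have := Real.log_nonneg hL1
    positivity
  have h1 : ‖s - 1‖ * (Real.log 2 + 519 * Real.log L) ≤ (10 * (π / L ^ 9)) * (520 * L) :=
    mul_le_mul hs.le (by linarith) hΛ0 (by positivity)
  have h2 : (10 * (π / L ^ 9)) * (520 * L) = 5200 * π / L ^ 8 := by field_simp; ring
  rw [h2] at h1
  refine h1.trans ?_
  rw [div_le_one (by positivity)]
  calc 5200 * π ≤ 5200 * 4 := by gcongr
    _ ≤ 4 ^ 8 := by norm_num
    _ ≤ L ^ 8 := h4pow 8

/-- Window bookkeeping for `𝓛 ≥ 4`: the contour parameters `U = π𝓛⁻³⁹⁵ = π𝓛₁/𝓛₂²`,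
`ρ = √2·U` satisfy `√(U² + (π𝓛₁/𝓛₂²)²) ≤ ρ ≤ 1` and `4π(t₀ + 𝓛₁)ρ² ≤ 1`, and
`e^{−(π𝓛₁/𝓛₂)²} = e^{−π²𝓛¹⁰} ≤ 𝓛⁻¹⁰`. [cite: Zhang2022LandauSiegel, §5 Lemma 5.4 (ii) (proof)] -/
theorem window_contour {L : ℝ} (hL : 4 ≤ L) :
    Real.sqrt ((π / L ^ 395) ^ 2 + (π * L ^ 405 / (L ^ 400) ^ 2) ^ 2) ≤ Real.sqrt 2 * π / L ^ 395 ∧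
      Real.sqrt 2 * π / L ^ 395 ≤ 1 ∧
      4 * π * (L ^ 519 + L ^ 405) * (Real.sqrt 2 * π / L ^ 395) ^ 2 ≤ 1 ∧
      Real.exp (-(π * L ^ 405 / L ^ 400) ^ 2) ≤ 1 / L ^ 10 := by
  obtain ⟨hpi4, _, _, hsq2pi, _, _, _⟩ := numeric_consts
  have hpi3 : 3 < π := Real.pi_gt_three
  have hL1 : 1 ≤ L := by linarith
  have hL0 : 0 < L := by linarith
  have hpow : ∀ a b : ℕ, a ≤ b → L ^ a ≤ L ^ b := fun a b h => pow_le_pow_right₀ hL1 h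
  have h4pow : ∀ n : ℕ, (4 : ℝ) ^ n ≤ L ^ n := fun n => pow_le_pow_left₀ (by norm_num) hL n
  have hU0 : 0 ≤ π / L ^ 395 := by positivity
  refine ⟨?_, ?_, ?_, ?_⟩
  · have e : π * L ^ 405 / (L ^ 400) ^ 2 = π / L ^ 395 := by field_simp
    rw [e, ← two_mul, Real.sqrt_mul' _ (sq_nonneg _), Real.sqrt_sq hU0]
    exact le_of_eq (by ring)
  · rw [div_le_one (by positivity)]
    calc Real.sqrt 2 * π ≤ 8 := hsq2pi
      _ ≤ 4 ^ 2 := by norm_num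
      _ ≤ L ^ 2 := h4pow 2
      _ ≤ L ^ 395 := hpow 2 395 (by norm_num)
  · have e : 4 * π * (L ^ 519 + L ^ 405) * (Real.sqrt 2 * π / L ^ 395) ^ 2
        = 8 * π ^ 3 * (L ^ 519 + L ^ 405) / L ^ 790 := by
      rw [div_pow, mul_pow, Real.sq_sqrt (by norm_num : (0 : ℝ) ≤ 2)]
      field_simp
      ring
    rw [e, div_le_one (by positivity)]
    have h2 : L ^ 519 + L ^ 405 ≤ 2 * L ^ 519 := by linarith [hpow 405 519 (by norm_num)]
    calc 8 * π ^ 3 * (L ^ 519 + L ^ 405) ≤ 8 * 4 ^ 3 * (2 * L ^ 519) := by gcongr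
      _ = 4 ^ 5 * L ^ 519 := by ring
      _ ≤ L ^ 5 * L ^ 519 := mul_le_mul_of_nonneg_right (h4pow 5) (by positivity)
      _ = L ^ 524 := by ring
      _ ≤ L ^ 790 := hpow 524 790 (by norm_num)
  · have e1 : (π * L ^ 405 / L ^ 400) ^ 2 = π ^ 2 * L ^ 10 := by field_simp
    have hpi1 : 1 ≤ π ^ 2 := by nlinarith
    rw [e1]; exact (exp_neg_mul_pow_le hL0 hpi1 10 1).trans (by norm_num)

/-- For `𝓛 ≥ 4`: `𝓛⁻¹⁰ ≤ α log 𝓛` (`α = π𝓛⁻⁹`, `π log 𝓛 ≥ 1`). [folklore] -/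
private theorem inv_pow_ten_le {L : ℝ} (hL : 4 ≤ L) : 1 / L ^ 10 ≤ π / L ^ 9 * Real.log L := by
  have hL0 : 0 < L := by linarith
  have hlogL1 : 1 ≤ Real.log L := by
    rw [Real.le_log_iff_exp_le hL0]
    have := Real.exp_one_lt_d9
    linarith
  have h1 : 1 ≤ π * Real.log L :=
    one_le_mul_of_one_le_of_one_le (by linarith [Real.pi_gt_three]) hlogL1
  rw [div_mul_eq_mul_div, le_div_iff₀ (by positivity)]
  calc 1 / L ^ 10 * L ^ 9 ≤ 1 / L ^ 10 * L ^ 10 :=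
        mul_le_mul_of_nonneg_left (pow_le_pow_right₀ (by linarith) (by norm_num)) (by positivity)
    _ = 1 := by field_simp
    _ ≤ π * Real.log L := h1

/-- **Lemma 5.4 (ii) with its size, under the manuscript's parameters**: for `𝓛 ≥ 4` and
`|s − 1| < 10α` (`α = π𝓛⁻⁹`), `‖δ(s) − 1‖ ≤ C·α·log 𝓛` with the absolute
`C = 20800 + (12·41! + 1344 + 5 + 18·10!) + 17592 + 1`: the window term `2|s−1|Λ(M_W+1)`,
`Λ = log 2 + 519 log 𝓛`, gives `≤ 20800·α log 𝓛`; the far part, `M_W` and `e^{−(π𝓛₁/𝓛₂)²}` are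
`≤ C'𝓛⁻¹⁰ ≤ C'·α log 𝓛`. [cite: Zhang2022LandauSiegel, §5 Lemma 5.4 (ii)] -/
theorem norm_delta514_sub_one_le_param {L : ℝ} (hL : 4 ≤ L) {s : ℂ}
    (hs : ‖s - 1‖ < 10 * (π / L ^ 9)) :
    ‖delta514 (L ^ 400) (L ^ 519) s - 1‖
      ≤ (20800 + (12 * (Nat.factorial 41 : ℝ) + 1344 + (5 + 18 * (Nat.factorial 10 : ℝ)))
          + 17592 + 1) * (π / L ^ 9) * Real.log L := by
  obtain ⟨hpi4, _, _, _, he3, _, hlog2⟩ := numeric_consts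
  have hpi3 : 3 < π := Real.pi_gt_three
  have hL1 : 1 ≤ L := by linarith
  have hL0 : 0 < L := by linarith
  have hpow : ∀ a b : ℕ, a ≤ b → L ^ a ≤ L ^ b := fun a b h => pow_le_pow_right₀ hL1 h
  have h4pow : ∀ n : ℕ, (4 : ℝ) ^ n ≤ L ^ n := fun n => pow_le_pow_left₀ (by norm_num) hL n
  have hL₂1 : (1 : ℝ) ≤ L ^ 400 := one_le_pow₀ hL1
  -- `σ`
  have h10a : 10 * (π / L ^ 9) ≤ 1 / 4 := by
    rw [show 10 * (π / L ^ 9) = 10 * π / L ^ 9 by ring, div_le_iff₀ (by positivity)]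
    calc 10 * π ≤ 40 := by linarith
      _ ≤ 1 / 4 * 4 ^ 9 := by norm_num
      _ ≤ 1 / 4 * L ^ 9 := mul_le_mul_of_nonneg_left (h4pow 9) (by norm_num)
  have hre : |s.re - 1| ≤ ‖s - 1‖ := by
    have h := Complex.abs_re_le_norm (s - 1)
    rwa [Complex.sub_re, Complex.one_re] at h
  have hσ := abs_le.mp (hre.trans hs.le)
  have hσ1 : 1 / 2 ≤ s.re := by linarith
  have hσ2 : s.re ≤ 3 / 2 := by linarith
  have hσ0 : 0 < s.re := by linarith
  -- logs
  have hlogL1 : 1 ≤ Real.log L := by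
    rw [Real.le_log_iff_exp_le hL0]; linarith
  have hlog2L : Real.log 2 ≤ Real.log L := Real.log_le_log (by norm_num) (by linarith)
  -- the structure of (ii) from the tree, at the window/contour parameters
  have hℓ : (0 : ℝ) < L ^ 405 := by positivity
  have hℓt : L ^ 405 < L ^ 519 := pow_lt_pow_right₀ (by linarith : (1 : ℝ) < L) (by norm_num)
  have hU0 : 0 ≤ π / L ^ 395 := by positivity
  obtain ⟨hρ, hρ1, hxρ, hE⟩ := window_contour hL
  have h := norm_delta514_sub_one_le_explicit (t₀ := L ^ 519) hL₂1 hℓ hℓt hσ0 (window_log_le hL)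
    (window_sΛ_le hL hs) hU0 hρ hρ1 hxρ
  -- the four sizes
  have hFAR := far_le hL hσ1 hσ2
  have hM := window_coeff_le hL
  -- name the atoms
  set a : ℝ := π / L ^ 9 with ha
  set FAR : ℝ := ∫ x in Ioi 0 \ Ioo (L ^ 519 - L ^ 405) (L ^ 519 + L ^ 405),
      ‖Delta510 (L ^ 400) (L ^ 519) x‖ * x ^ (s.re - 1) with hFARdef
  set M : ℝ := 2 * L ^ 405 * ((1 + Real.exp (1 / (8 * (L ^ 400) ^ 2)))
      * (Real.sqrt (2 * π) / L ^ 400) * Real.exp (-((L ^ 400) ^ 2 * (π / L ^ 395) ^ 2 / 2)))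
    + (Real.sqrt 2 * π / L ^ 395 + 4 * π * (L ^ 519 + L ^ 405) * (Real.sqrt 2 * π / L ^ 395) ^ 2)
      * (1 + 4 * π * (L ^ 405) ^ 2 / (L ^ 400) ^ 2
        * Real.exp (-((L ^ 400) ^ 2 * (π / L ^ 395) ^ 2))) with hMdef
  set E : ℝ := Real.exp (-(π * L ^ 405 / L ^ 400) ^ 2) with hEdef
  set Λ : ℝ := Real.log 2 + 519 * Real.log L with hΛdef
  set CF : ℝ := 12 * (Nat.factorial 41 : ℝ) + 1344 + (5 + 18 * (Nat.factorial 10 : ℝ)) with hCFdef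
  have ha0 : 0 < a := by positivity
  have hΛle : Λ ≤ 520 * Real.log L := by rw [hΛdef]; linarith
  have hΛ0 : 0 ≤ Λ := by
    rw [hΛdef]; have := Real.log_nonneg (by norm_num : (1 : ℝ) ≤ 2); positivity
  have hM0 : 0 ≤ M := by rw [hMdef]; positivity
  have hM1 : M ≤ 1 := by
    refine hM.trans ?_
    rw [div_le_one (by positivity)]
    calc (17592 : ℝ) ≤ 4 ^ 15 := by norm_num
      _ ≤ L ^ 15 := h4pow 15
  -- the main (window) term
  have hmain : 2 * ‖s - 1‖ * Λ * (M + 1) ≤ 20800 * (a * Real.log L) := by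
    have h1 : ‖s - 1‖ * Λ ≤ (10 * a) * (520 * Real.log L) :=
      mul_le_mul hs.le hΛle hΛ0 (by positivity)
    have h0' : 0 ≤ 10 * a * (520 * Real.log L) := by positivity
    have h2 : (M + 1) ≤ 2 := by linarith
    calc 2 * ‖s - 1‖ * Λ * (M + 1) = 2 * ((‖s - 1‖ * Λ) * (M + 1)) := by ring
      _ ≤ 2 * ((10 * a) * (520 * Real.log L) * 2) := by
          have := mul_le_mul h1 h2 (by linarith) h0'
          linarith
      _ = 20800 * (a * Real.log L) := by ring
  -- the small terms against `α log 𝓛`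
  have hsmall : 1 / L ^ 10 ≤ a * Real.log L := by rw [ha]; exact inv_pow_ten_le hL
  have h15 : 1 / L ^ 15 ≤ 1 / L ^ 10 :=
    div_le_div_of_nonneg_left (by norm_num) (by positivity) (hpow 10 15 (by norm_num))
  have hCF0 : 0 ≤ CF := by rw [hCFdef]; positivity
  have hFAR' : FAR ≤ CF * (a * Real.log L) := by
    refine hFAR.trans ?_
    rw [div_eq_mul_one_div]
    exact mul_le_mul_of_nonneg_left (h15.trans hsmall) hCF0
  have hM' : M ≤ 17592 * (a * Real.log L) := by
    refine hM.trans ?_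
    rw [div_eq_mul_one_div]
    exact mul_le_mul_of_nonneg_left (h15.trans hsmall) (by norm_num)
  have hE' : E ≤ 1 * (a * Real.log L) := by rw [one_mul]; exact hE.trans hsmall
  have htot : FAR + 2 * ‖s - 1‖ * Λ * (M + 1) + M + E
      ≤ (20800 + CF + 17592 + 1) * a * Real.log L := by
    have := add_le_add (add_le_add (add_le_add hFAR' hmain) hM') hE'
    linarith
  exact h.trans htot

end Lemma53

end Literature.NumberTheory.LFunctions.Zhang2022
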